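import Summits.ABC.IUTFork.Repair.RHTameCellQ3Dichotomy
import HarnessLib

/-!
# R-H ROUND 2, Q1/Q3 interface for rows 5 / 16 (band cell): the per-place WINDOW is an initial label segment `j ≲ e_w/P_w ≈ 2l/H`

Seat abc-iut-rh-tst-5 (R-H PAIR n = 5 TESTER, gen 3). PROOF-ONLY over abc-iut-rh-typ-5's `RH.TameBandLicence.Cell` (p458742) and this
seat's `RHTameCellQ3Dichotomy` (p469797, proxy-filed). No `def`, no new `Prop`, no instance. HONEST FRAMING: nothing here asserts abc
proved or refuted; no side is taken on [IUTchIII] Cor. 3.12 or on any author; H⋆ rows are hypotheses; typed ≠ proved; computed ≠ proved.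

THE SANDWICH (dictionary-free, every label). For integers `e ≥ 1`, `j ≥ 1`, any `P`:
  `(j+1)·P ≤ e − 1 ⟹ Cell e P j ⟹ (j−1)·P ≤ e − 1`
(`cell_of_succ_mul_le` below; the right arrow is typ-5's `linear_of_cell`, contrapositive `not_cell_of_linear_lt` in p469797). Hence at a
bad place `w` with integers `(e_w, P_w)` the set of labels `j ≤ l⋆` at which the row-5 cell (= the row-16 cell on `p ∤ e_w`, tame
different) holds — the place's share of `Σ₅` / `Σ₁₆` — satisfies `{1,…,j₀−1} ⊆ W_w ⊆ {1,…,j₀+1}`, `j₀ := ⌊(e_w−1)/P_w⌋`: an initial segment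
up to two boundary labels. In the dictionary `e_w = c·e_v·l`, `2P_w = c·e_v·H` (`2l·P_w = e(w|v)·ord_v(q_v)`, `l ∣ e(w|v)`,
`ord_v(q_v) = e_v·H`; Frey: `H = ord_p Δ_E = 2v_p(abc)` at odd `p`) this reads `(j+1)·H ≤ 2l − 1 ⟹ IN`, `(j−1)·H ≥ 2l ⟹ OFF`
(`cell_of_succ_mul_H_le`, `not_cell_of_two_l_le_pred_mul_H`): the window is the initial segment of length `2l/H ± 1`, a fraction
`≈ 4/H` of the `l⋆ = (l−1)/2` labels, `l`-FREE — the every-label form of p469797's top-label dichotomy `Cell ↔ H ≤ 4`.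
TABLE OF RECORD (plan/rescue/R-W/WINDOW-TABLE.tsv, one writer rw-num-lead; checked v4.16 922c2ddf2f400ea3 at 6118 numeric packet rows, all
families and strata incl. wild): 6118/6118 windows are EXACTLY initial segments `{1..w}` and 6118/6118 obey `j₀−1 ≤ w ≤ j₀+1`
(histogram `w − max(0, min(l⋆, j₀−1))`: 0 ×2298, 1 ×2040, 2 ×1780). Kernel spot-checks of two windows with their boundary labels: `window_rows`.
Consequence recorded for the Q1 currency of record (rh-lead g2 21:33:43Z (R3), xi-1's `E_off⁺ = (1/l⋆)·Σ(−margin_cell/e_w)·ln p`,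
`gap = ((l+1)/24 − 1/(2l))·ln q^{∤{2,l}}`): per place `ρ_w := E_off,w⁺/gap_w` depends on `H` alone up to `O(1/l)` (0 iff `H ≤ 4`,
then increasing to 1) — a NUMERICS statement checked on the same table (staged `Q3-rho-vs-WINDOW-TABLE.txt`), not a theorem of this file.
[cite: Mochizuki2012, IUTchI Ex. 3.2 (iv) p. 71; IUTchIV Prop. 1.2 (i)(ii) p. 10] [claim: Mochizuki2012, status: disputed]
-/

namespace Summit.ABC.IUTFork.Repair.RH.TameBandLicence

/-! ## §1. The sufficient half of the sandwich (the necessary half is typ-5's `linear_of_cell`) -/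

/-- **IN the window: `(j+1)·P ≤ e − 1` ⟹ the cell holds** (by its band-top half: `(j²−1)P = (j−1)·((j+1)P) ≤ (j−1)(e−1) ≤ j(e−1)`).
No sign condition on `P`. [folklore] -/
theorem cell_of_succ_mul_le {e P j : ℤ} (he : 1 ≤ e) (hj : 1 ≤ j) (h : (j + 1) * P ≤ e - 1) : Cell e P j := by
  refine cell_of_bandTop (by omega) ?_
  have h1 : (j - 1) * ((j + 1) * P) ≤ (j - 1) * (e - 1) := mul_le_mul_of_nonneg_left h (by omega)
  have h2 : (j - 1) * (e - 1) ≤ j * (e - 1) := by nlinarith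
  have h3 : (j ^ 2 - 1) * P = (j - 1) * ((j + 1) * P) := by ring
  rw [h3]
  exact h1.trans h2

/-- **The sandwich at one glance**: `(j+1)·P ≤ e − 1 ⟹ Cell e P j` and `Cell e P j ⟹ (j−1)·P ≤ e − 1`. [folklore] -/
theorem cell_sandwich {e P j : ℤ} (he : 1 ≤ e) (hj : 1 ≤ j) :
    ((j + 1) * P ≤ e - 1 → Cell e P j) ∧ (Cell e P j → (j - 1) * P ≤ e - 1) :=
  ⟨cell_of_succ_mul_le he hj, linear_of_cell he hj⟩

/-! ## §2. In the dictionary `e = c·e_v·l`, `2P = c·e_v·H`: IN for `(j+1)·H ≤ 2l − 1`, OFF for `(j−1)·H ≥ 2l` -/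

/-- **IN: every label with `(j+1)·H ≤ 2l − 1`** (`c, e_v ≥ 1`, `1 ≤ j ≤ l`; integrality turns `2(j+1)P ≤ 2e − c·e_v` into
`(j+1)P ≤ e − 1`). [folklore] -/
theorem cell_of_succ_mul_H_le {c ev e P H l j : ℤ} (hc : 1 ≤ c) (hev : 1 ≤ ev) (hP : 2 * P = c * ev * H)
    (he : e = c * ev * l) (hj : 1 ≤ j) (hjl : j ≤ l) (h : (j + 1) * H ≤ 2 * l - 1) : Cell e P j := by
  have hce : 1 ≤ c * ev := by nlinarith
  have he1 : 1 ≤ e := by rw [he]; nlinarith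
  have h1 : (j + 1) * H * (c * ev) ≤ (2 * l - 1) * (c * ev) := mul_le_mul_of_nonneg_right h (by omega)
  have h2 : 2 * ((j + 1) * P) = (j + 1) * H * (c * ev) := by
    rw [show 2 * ((j + 1) * P) = (j + 1) * (2 * P) by ring, hP]; ring
  have h3 : (2 * l - 1) * (c * ev) = 2 * e - c * ev := by rw [he]; ring
  have h4 : 2 * ((j + 1) * P) ≤ 2 * e - 2 := by omega
  exact cell_of_succ_mul_le he1 hj (by omega)

/-- **OFF: every label with `(j−1)·H ≥ 2l`** (`c, e_v ≥ 1`, `l, j ≥ 1`): then `(j−1)P ≥ e > e − 1`, against `linear_of_cell`. [folklore] -/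
theorem not_cell_of_two_l_le_pred_mul_H {c ev e P H l j : ℤ} (hc : 1 ≤ c) (hev : 1 ≤ ev) (hP : 2 * P = c * ev * H)
    (he : e = c * ev * l) (hl : 1 ≤ l) (hj : 1 ≤ j) (h : 2 * l ≤ (j - 1) * H) : ¬ Cell e P j := by
  have hce : 1 ≤ c * ev := by nlinarith
  have he1 : 1 ≤ e := by rw [he]; nlinarith
  refine not_cell_of_linear_lt he1 hj ?_
  have h1 : 2 * l * (c * ev) ≤ (j - 1) * H * (c * ev) := mul_le_mul_of_nonneg_right h (by omega)
  have h2 : 2 * ((j - 1) * P) = (j - 1) * H * (c * ev) := by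
    rw [show 2 * ((j - 1) * P) = (j - 1) * (2 * P) by ring, hP]; ring
  have h3 : 2 * l * (c * ev) = 2 * e := by rw [he]; ring
  omega

/-- The same two thresholds from the bed's own integers: `2l·P_w = e(w|v)·ord_v(q_v)` (abc-iut-w5-d009
`licence_settingPrVolSharp_pilotDataOfK_iff_of_tame_explicit`: `P_w = e(w|v)·ord_v(q_v)/(2l)`), `e_w = e(w|v)·e(v|p)`, `l ∣ e(w|v)`,
`ord_v(q_v) = e(v|p)·H`. IN half. [folklore] -/
theorem cell_of_bed_window {l ewv ev e P Q H j : ℤ} (hl : 1 ≤ l) (hev : 1 ≤ ev) (hewv : 1 ≤ ewv)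
    (hPw : 2 * l * P = ewv * Q) (hew : e = ewv * ev) (hdiv : l ∣ ewv) (hQ : Q = ev * H)
    (hj : 1 ≤ j) (hjl : j ≤ l) (h : (j + 1) * H ≤ 2 * l - 1) : Cell e P j := by
  obtain ⟨c, hc⟩ := hdiv
  have hc1 : 1 ≤ c := by nlinarith
  have hP : 2 * P = c * ev * H := by
    have h1 : l * (2 * P) = l * (c * ev * H) := by
      calc l * (2 * P) = 2 * l * P := by ring
        _ = ewv * Q := hPw
        _ = l * (c * ev * H) := by rw [hc, hQ]; ring
    exact mul_left_cancel₀ (by omega) h1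
  exact cell_of_succ_mul_H_le hc1 hev hP (by rw [hew, hc]; ring) hj hjl h

/-- OFF half from the bed's integers. [folklore] -/
theorem not_cell_of_bed_offWindow {l ewv ev e P Q H j : ℤ} (hl : 1 ≤ l) (hev : 1 ≤ ev) (hewv : 1 ≤ ewv)
    (hPw : 2 * l * P = ewv * Q) (hew : e = ewv * ev) (hdiv : l ∣ ewv) (hQ : Q = ev * H)
    (hj : 1 ≤ j) (h : 2 * l ≤ (j - 1) * H) : ¬ Cell e P j := by
  obtain ⟨c, hc⟩ := hdiv
  have hc1 : 1 ≤ c := by nlinarith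
  have hP : 2 * P = c * ev * H := by
    have h1 : l * (2 * P) = l * (c * ev * H) := by
      calc l * (2 * P) = 2 * l * P := by ring
        _ = ewv * Q := hPw
        _ = l * (c * ev * H) := by rw [hc, hQ]; ring
    exact mul_left_cancel₀ (by omega) h1
  exact not_cell_of_two_l_le_pred_mul_H hc1 hev hP (by rw [hew, hc]; ring) hl hj h

/-! ## §3. Kernel spot-checks: two whole windows with their boundary labels -/

/-- HEX `k = 3`, `l = 17`, `e_v = 5` (`e_w = 85`, `P_w = 15`, `H = 6`, `j₀ = ⌊84/15⌋ = 5`): window `{1,…,6}` of `l⋆ = 8` labels — IN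
through `j = 6 = j₀+1`, OFF from `j = 7`. Frey `(e_w, P_w) = (115, 15)` (`l = 23`, `c·e_v = 5`, `H = 6`, `j₀ = 7`): window `{1,…,8}` of
`l⋆ = 11` — IN through `j = 8 = j₀+1`, OFF from `j = 9`. (Both boundary labels fall IN here; the table has all three cases.) [folklore] -/
theorem window_rows :
    (Cell 85 15 1 ∧ Cell 85 15 2 ∧ Cell 85 15 3 ∧ Cell 85 15 4 ∧ Cell 85 15 5 ∧ Cell 85 15 6 ∧ ¬ Cell 85 15 7 ∧ ¬ Cell 85 15 8) ∧
    (Cell 115 15 6 ∧ Cell 115 15 7 ∧ Cell 115 15 8 ∧ ¬ Cell 115 15 9 ∧ ¬ Cell 115 15 10 ∧ ¬ Cell 115 15 11) := by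
  simp only [Cell]
  decide

end Summit.ABC.IUTFork.Repair.RH.TameBandLicence
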